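import Summits.QuantumAdvantage.QuantumAdvantage.Theorems.CubicForrelationNearExactIsExactSymplecticSix
import Summits.QuantumAdvantage.QuantumAdvantage.Theorems.CubicForrelationNearExactIsExactFourteenTypeO

/-!
# Crux `CubicForrelation.NearExactIsExact` (stmt-QuantumAdvantage-14043) — n = 16, TWO-SIDED: a type-O cubic never reaches `Φ = 31/32`

Certificate seat `b2b-cforr-cert` (gen 4).  HONEST FRAMING: a theorem about cubic Boolean functions on 16 bits (the finite slice `n = 16` of
the crux) — one of the boundary configurations of the certified bound `θ₁₆ ≤ 31/32` is excluded two-sidedly; NOT summit progress, and NOT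
yet the full statement `Φ ≥ 31/32 ⇒ Φ = 1` on 16 bits (the level-7, level-8 and split configurations remain, see the gen-4 write-up).

`st_typeO_sixteen_lt`: for cubic `f, g : 𝔽₂¹⁶ → 𝔽₂` with `W_g = 64·u` and ALL `u` odd (type O), `Φ(f,g) < 31/32`.  (The one-sided tower
gives `≤ 31/32` for type O, `isolation_sixteen_31_32`; the boundary is Parseval-consistent one-sidedly.)  Proof:
* BUDGET `Σ_x (u − 4(−1)^f)² = 2²¹(1 − Φ) ≤ 2¹⁶` with `2¹⁶` odd squares ⇒ `τ := u − 4(−1)^f = ±1` everywhere, and `τ = (−1)^{d₁}` with the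
  QUADRATIC digit `d₁ = [⌊u/2⌋ odd]` (`sx_digitOne`).
* FOURIER: `W_{d₁} = 256·ρ`, `ρ := 4(−1)^g − u_f ∈ ℤ` (`W_f = 64u_f`); Parseval for `d₁` and for `f` give `Σρ² = 2¹⁶`, `Σ(−1)^g ρ = 2¹³`,
  and `|ρ| ≤ 256`, so `W_{d₁} ≠ 0` on at least `32` points.
* RADICAL (`st_card_supp_mul_radical_le`, general `n`): for a quadratic `q`, `#supp(W_q) · #R ≤ 2ⁿ` where `R` is the radical of its second
  derivative (a radical vector `a` makes `(−1)^q` an `a`-eigenfunction, pinning `supp W_q` inside a coset of `R^⊥`).  Hence `#R ≤ 2¹¹`.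
* SYMPLECTIC EXTRACTION (`ss_extract3`, `ss_flat_signsum6`): three orthogonal hyperbolic pairs, a parametrised 6-flat with sign sum `±8`; but
  GENERAL FLAT SUMS (`fs_flat_sum_dvd`, `k = 6`: `Σ_ε u ≡ 0 (mod 16)`, and `4Σ_ε(−1)^f ≡ 0 (mod 16)` by Ax on the flat for the cubic `f`) force
  every parametrised 6-flat sign sum of `τ` to vanish `mod 16`. Contradiction.

References: J. Ax (1964) / R. J. McEliece (1972) (Carlet 2021 §4.1); MacWilliams–Sloane (1977) Ch. 15; R. O'Donnell (2014) §3.3; S. Aaronson,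
A. Ambainis, SIAM J. Comput. 47 (2018) §1.1.1.  Everything below is proved from Mathlib and the tree; axioms are the standard three.
-/

set_option linter.dupNamespace false -- D-0017: single-problem summit ⇒ `QuantumAdvantage.QuantumAdvantage` by design

noncomputable section

namespace Summit.QuantumAdvantage.QuantumAdvantage.Theorems.CubicForrelation.NearExactIsExact

open Finset
open Literature.Computability.QuantumComplexity
open Literature.Computability.QuantumComplexity.BuzetChailloux (bxor zeroVec bxor_bxor_cancel_left bxor_zeroVec zeroVec_bxor bxor_comm
  signOf_sq twist_bxor_right)
open Literature.Computability.QuantumComplexity.DerivativeWalsh (W sum_W_sq twist_bxor_left card_mul_card_perp)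

variable {n : ℕ}

/-! ### The radical pins the Walsh support (general `n`) -/

/-- **`#supp(W_q) · #R ≤ 2ⁿ` for a quadratic `q` with radical `R`.**  If `a ∈ R` (all second derivatives `B(a,·)` vanish) then
`q(x ⊕ a) = q(x) ⊕ c_a`, so `W_q(y) = (−1)^{c_a}(−1)^{a·y} W_q(y)`: wherever `W_q ≠ 0` the character `y ↦ (−1)^{a·y}` is pinned, and the
non-vanishing set lies in one coset of `R^⊥` (`|R|·|R^⊥| = 2ⁿ`, `card_mul_card_perp`). [cite: Carlet2020, §5.2] -/
theorem st_card_supp_mul_radical_le (q : (Fin n → Bool) → Bool) (hq : IsDegLeFun 2 q) :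
    #(univ.filter fun y : Fin n → Bool => W (fun x => signOf (q x)) y ≠ 0) *
      #(univ.filter fun a : Fin n → Bool => ∀ b, (q zeroVec ^^ q a ^^ q b ^^ q (bxor a b)) = false) ≤ 2 ^ n := by
  classical
  set R := univ.filter (fun a : Fin n → Bool => ∀ b, (q zeroVec ^^ q a ^^ q b ^^ q (bxor a b)) = false) with hRdef
  set Y := univ.filter (fun y : Fin n → Bool => W (fun x => signOf (q x)) y ≠ 0) with hYdef
  have hadd := es_B_add_left q hq
  have hR0 : zeroVec ∈ R := by
    refine mem_filter.2 ⟨mem_univ _, fun b => ?_⟩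
    rw [zeroVec_bxor]; cases q zeroVec <;> cases q b <;> rfl
  have hRadd : ∀ a ∈ R, ∀ a' ∈ R, bxor a a' ∈ R := by
    intro a ha a' ha'
    refine mem_filter.2 ⟨mem_univ _, fun b => ?_⟩
    rw [hadd, (mem_filter.1 ha).2 b, (mem_filter.1 ha').2 b]; rfl
  -- a radical vector pins the character on the support
  have hpin : ∀ a ∈ R, ∀ y ∈ Y, twist a y = signOf (q zeroVec ^^ q a) := by
    intro a ha y hy
    have hD : ∀ x, q (bxor x a) = (q x ^^ (q zeroVec ^^ q a)) := by
      intro x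
      have h := (mem_filter.1 ha).2 x
      rw [bxor_comm] at h
      revert h
      cases q zeroVec <;> cases q a <;> cases q x <;> cases q (bxor x a) <;> decide
    have hre : W (fun x => signOf (q x)) y = ∑ x, signOf (q (bxor x a)) * twist (bxor x a) y := by
      show (∑ x, signOf (q x) * twist x y) = _
      exact (Fintype.sum_equiv (Equiv.mk (fun x => bxor x a) (fun x => bxor x a)
        (fun x => by simp [iw_bxor_assoc]) (fun x => by simp [iw_bxor_assoc]))
        (fun x => signOf (q (bxor x a)) * twist (bxor x a) y) (fun x => signOf (q x) * twist x y) fun x => rfl).symm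
    have hre' : W (fun x => signOf (q x)) y = signOf (q zeroVec ^^ q a) * twist a y * W (fun x => signOf (q x)) y :=
      calc W (fun x => signOf (q x)) y = ∑ x, signOf (q (bxor x a)) * twist (bxor x a) y := hre
        _ = ∑ x, signOf (q zeroVec ^^ q a) * twist a y * (signOf (q x) * twist x y) :=
            sum_congr rfl fun x _ => by rw [hD x, signOf_xor, twist_bxor_left]; ring
        _ = signOf (q zeroVec ^^ q a) * twist a y * W (fun x => signOf (q x)) y := by rw [← mul_sum]; rfl
    have hW0 : W (fun x => signOf (q x)) y ≠ 0 := (mem_filter.1 hy).2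
    have hprod : signOf (q zeroVec ^^ q a) * twist a y = 1 := by
      have : (signOf (q zeroVec ^^ q a) * twist a y - 1) * W (fun x => signOf (q x)) y = 0 := by linarith
      have h2 := (mul_eq_zero.1 this).resolve_right hW0
      linarith
    have hs : signOf (q zeroVec ^^ q a) = 1 ∨ signOf (q zeroVec ^^ q a) = -1 := by
      unfold signOf; split_ifs <;> simp
    rcases Simon.twist_eq_one_or a y with ht | ht <;> rcases hs with hs | hs
    · rw [ht, hs]
    · rw [ht, hs] at hprod; norm_num at hprod
    · rw [ht, hs] at hprod; norm_num at hprod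
    · rw [ht, hs]
  -- hence `Y` injects into `R^⊥`
  by_cases hY : Y = ∅
  · rw [hY, card_empty, zero_mul]; exact Nat.zero_le _
  obtain ⟨y₀, hy₀⟩ := nonempty_iff_ne_empty.2 hY
  have hinj : #Y ≤ #(univ.filter fun z : Fin n → Bool => ∀ a ∈ R, twist a z = 1) := by
    refine card_le_card_of_injOn (fun y => bxor y₀ y) (fun y hy => ?_) (fun y _ y' _ h => ?_)
    · refine mem_filter.2 ⟨mem_univ _, fun a ha => ?_⟩
      rw [twist_bxor_right, hpin a ha y₀ hy₀, hpin a ha y hy]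
      unfold signOf; split_ifs <;> norm_num
    · simpa only [bxor_bxor_cancel_left] using congrArg (bxor y₀) h
  have hperp := card_mul_card_perp hR0 hRadd
  have h' : ((#Y * #R : ℕ) : ℝ) ≤ ((2 ^ n : ℕ) : ℝ) := by
    push_cast
    calc (#Y : ℝ) * #R ≤ #(univ.filter fun z : Fin n → Bool => ∀ a ∈ R, twist a z = 1) * #R := by
          exact mul_le_mul_of_nonneg_right (by exact_mod_cast hinj) (Nat.cast_nonneg _)
      _ = 2 ^ n := by rw [mul_comm]; exact hperp
  exact_mod_cast h'

/-! ### Parseval and the two-sided budget on 16 bits -/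

/-- Parseval on 16 bits: `Σ_x W_g(x)² = 2³²`. [folklore] -/
theorem st_parseval16 (g : (Fin (8 + 8) → Bool) → Bool) : ∑ x, W (fun y => signOf (g y)) x ^ 2 = (2 : ℝ) ^ 32 := by
  rw [sum_W_sq, sum_congr rfl fun y _ => signOf_sq (g y), sum_const, card_univ, Fintype.card_fun, Fintype.card_bool,
    Fintype.card_fin]
  norm_num

/-- **Two-sided budget at the Ax base level on 16 bits.** With `W_g = 64u` and `s = (−1)^f`: `Σ_x (u − 4s)² = 2²¹·(1 − Φ(f,g))`.
[this work] -/
theorem st_budget6 (f g : (Fin (8 + 8) → Bool) → Bool) (u : (Fin (8 + 8) → Bool) → ℤ)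
    (hu : ∀ x, W (fun y => signOf (g y)) x = (2 : ℝ) ^ 6 * (u x : ℝ)) :
    ((∑ x, (u x - 4 * sZ (f x)) ^ 2 : ℤ) : ℝ) = (2 : ℝ) ^ 21 * (1 - forrelation f g) := by
  have hP := st_parseval16 g
  have hΦ := vg_two_pow_mul_forrelation f g
  have e : ∀ x : Fin (8 + 8) → Bool, ((u x : ℝ) - 4 * (sZ (f x) : ℝ)) ^ 2 =
      W (fun y => signOf (g y)) x ^ 2 / 4096 - signOf (f x) * W (fun y => signOf (g y)) x / 8 + 16 := by
    intro x
    have hux : (u x : ℝ) = W (fun y => signOf (g y)) x / 64 := by rw [hu x]; ring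
    have hs2 : signOf (f x) ^ 2 = 1 := signOf_sq _
    rw [tp_sZ_cast, hux]
    nlinarith [hs2]
  push_cast
  rw [sum_congr rfl fun x _ => e x, sum_add_distrib, sum_sub_distrib, ← sum_div, ← sum_div, hP, ← hΦ, sum_const,
    card_univ, Fintype.card_fun, Fintype.card_bool, Fintype.card_fin]
  norm_num
  ring

/-- **Type-O rigidity at the boundary on 16 bits.** For cubic `g` with `W_g = 64u`, all `u` odd and `Φ(f,g) ≥ 31/32`, the residual
`u − 4(−1)^f` is `±1` at every point. [this work] -/
theorem st_residual_pm_one (f g : (Fin (8 + 8) → Bool) → Bool) (u : (Fin (8 + 8) → Bool) → ℤ)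
    (hu : ∀ x, W (fun y => signOf (g y)) x = (2 : ℝ) ^ 6 * (u x : ℝ)) (hodd : ∀ x, Odd (u x))
    (hΦ : (31 / 32 : ℝ) ≤ forrelation f g) : ∀ x, u x - 4 * sZ (f x) = 1 ∨ u x - 4 * sZ (f x) = -1 := by
  have hB : (∑ x, (u x - 4 * sZ (f x)) ^ 2 : ℤ) ≤ 65536 := by
    have h := st_budget6 f g u hu
    have h' : ((∑ x, (u x - 4 * sZ (f x)) ^ 2 : ℤ) : ℝ) ≤ 65536 := by rw [h]; nlinarith
    exact_mod_cast h'
  have hnonneg : ∀ x, 0 ≤ (u x - 4 * sZ (f x)) ^ 2 - 1 := fun x => by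
    have := ft_sq_ge_one (tp_sZ_cases (f x)) (hodd x); linarith
  have hsum0 : ∑ x, ((u x - 4 * sZ (f x)) ^ 2 - 1 : ℤ) = 0 := by
    refine le_antisymm ?_ (sum_nonneg fun x _ => hnonneg x)
    rw [sum_sub_distrib, sum_const, card_univ, Fintype.card_fun, Fintype.card_bool, Fintype.card_fin]
    norm_num
    linarith
  intro x
  have h := (sum_eq_zero_iff_of_nonneg fun y _ => hnonneg y).1 hsum0 x (mem_univ x)
  have h1 : (u x - 4 * sZ (f x)) * (u x - 4 * sZ (f x)) = 1 := by rw [← pow_two]; linarith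
  exact mul_self_eq_one_iff.1 h1

/-! ### The type-O exclusion at the boundary -/

/-- **A type-O cubic on 16 bits never reaches `Φ = 31/32`.**  For cubic `f, g : 𝔽₂¹⁶ → 𝔽₂` with `W_g = 64·u` and every `u(x)` odd:
`Φ(f,g) < 31/32`.  Two-sided (budget ⇒ residual `(−1)^{d₁}` with `d₁` quadratic; Fourier ⇒ `W_{d₁} = 256ρ` with `≥ 32` non-zero values ⇒
radical `≤ 2¹¹`; three hyperbolic pairs ⇒ a 6-flat sign sum `±8` against the flat-sum congruence `≡ 0 (mod 16)`).  Finite-slice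
statement; NOT summit progress. [this work] -/
theorem st_typeO_sixteen_lt (f g : (Fin (8 + 8) → Bool) → Bool) (hf : IsDegLeFun 3 f) (hg : IsDegLeFun 3 g)
    (ug : (Fin (8 + 8) → Bool) → ℤ) (hug : ∀ x, W (fun y => signOf (g y)) x = (2 : ℝ) ^ 6 * (ug x : ℝ))
    (hog : ∀ x, Odd (ug x)) : forrelation f g < 31 / 32 := by
  classical
  by_contra hge
  push Not at hge
  obtain ⟨uf, huf⟩ := tw_base f hf 6 (by norm_num)
  -- (1) residual `±1`, equal to the sign of the quadratic digit
  have hτ := st_residual_pm_one f g ug hug hog hge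
  have hd₁ : IsDegLeFun 2 (fun x => decide (Odd (ug x / 2))) := sx_digitOne g ug hg hug
  have hτeq : ∀ x, ug x - 4 * sZ (f x) = sZ (decide (Odd (ug x / 2))) := by
    intro x
    rcases hτ x with h | h
    · have hu : ug x / 2 = 2 * sZ (f x) := by omega
      have hev : ¬ Odd (ug x / 2) := by rw [hu, Int.not_odd_iff_even]; exact even_two_mul _
      rw [h, decide_eq_false hev]; rfl
    · have hu : ug x / 2 = 2 * sZ (f x) - 1 := by omega
      have hod : Odd (ug x / 2) := by rw [hu]; exact ⟨sZ (f x) - 1, by ring⟩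
      rw [h, decide_eq_true hod]; rfl
  -- (2) Fourier: `W_{d₁}(y) = 256·ρ(y)` with `ρ = 4(−1)^g − u_f`
  have hinv : ∀ y, ∑ x, (ug x : ℝ) * twist x y = 1024 * signOf (g y) := by
    intro y
    have h := tz_inversion (fun z => signOf (g z)) y
    rw [sum_congr rfl fun x _ => by rw [hug x]] at h
    have e : ∑ x, (2 : ℝ) ^ 6 * (ug x : ℝ) * twist x y = 2 ^ 6 * ∑ x, (ug x : ℝ) * twist x y := by
      rw [mul_sum]
      exact sum_congr rfl fun x _ => by ring
    rw [e] at h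
    have h' : (2 : ℝ) ^ 6 * (∑ x, (ug x : ℝ) * twist x y - 1024 * signOf (g y)) = 0 := by
      rw [mul_sub, h]; norm_num; ring
    have h2 : (2 : ℝ) ^ 6 ≠ 0 := by positivity
    linarith [(mul_eq_zero.1 h').resolve_left h2]
  have hWd : ∀ y, W (fun x => signOf (decide (Odd (ug x / 2)))) y = 256 * (((4 * sZ (g y) - uf y : ℤ)) : ℝ) := by
    intro y
    unfold W
    have e : ∀ x, signOf (decide (Odd (ug x / 2))) * twist x y = (ug x : ℝ) * twist x y - 4 * (signOf (f x) * twist x y) := by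
      intro x
      rw [← tp_sZ_cast, ← hτeq x, ← tp_sZ_cast]
      push_cast
      ring
    rw [sum_congr rfl fun x _ => e x, sum_sub_distrib, ← mul_sum, hinv y]
    have hWf : ∑ x, signOf (f x) * twist x y = (2 : ℝ) ^ 6 * (uf y : ℝ) := huf y
    rw [hWf]
    push_cast
    rw [tp_sZ_cast]
    ring
  -- (3) Parseval for `d₁` and for `f`: `Σρ² = 2¹⁶`, `Σ (−1)^g ρ = 2¹³`
  have hPd := st_parseval16 (fun x => decide (Odd (ug x / 2)))
  have hρ2 : ∑ y, ((((4 * sZ (g y) - uf y : ℤ)) : ℝ)) ^ 2 = 65536 := by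
    rw [sum_congr rfl fun y _ => by rw [hWd y]] at hPd
    have e : ∀ y, (256 * (((4 * sZ (g y) - uf y : ℤ)) : ℝ)) ^ 2 = 65536 * ((((4 * sZ (g y) - uf y : ℤ)) : ℝ)) ^ 2 :=
      fun y => by ring
    rw [sum_congr rfl fun y _ => e y, ← mul_sum, show (2 : ℝ) ^ 32 = 65536 * 65536 by norm_num] at hPd
    linarith
  have hPf := st_parseval16 f
  have hSρ : ∑ y, signOf (g y) * (((4 * sZ (g y) - uf y : ℤ)) : ℝ) = 8192 := by
    have e : ∀ y, W (fun x => signOf (f x)) y ^ 2 =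
        65536 - 32768 * (signOf (g y) * (((4 * sZ (g y) - uf y : ℤ)) : ℝ)) + 4096 * ((((4 * sZ (g y) - uf y : ℤ)) : ℝ)) ^ 2 := by
      intro y
      have hs2 : signOf (g y) ^ 2 = 1 := signOf_sq _
      have hW : W (fun x => signOf (f x)) y = 256 * signOf (g y) - 64 * (((4 * sZ (g y) - uf y : ℤ)) : ℝ) := by
        rw [huf y]; push_cast; rw [tp_sZ_cast]; ring
      rw [hW]
      nlinarith [hs2]
    have hsum := hPf
    rw [sum_congr rfl fun y _ => e y, sum_add_distrib, sum_sub_distrib, sum_const, card_univ, Fintype.card_fun,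
      Fintype.card_bool, Fintype.card_fin, nsmul_eq_mul, ← mul_sum, ← mul_sum, hρ2] at hsum
    set S := ∑ y, signOf (g y) * (((4 * sZ (g y) - uf y : ℤ)) : ℝ) with hS
    norm_num at hsum
    linarith
  -- (4) at least `32` non-zero values of `W_{d₁}`
  set Y := univ.filter (fun y : Fin (8 + 8) → Bool => W (fun x => signOf (decide (Odd (ug x / 2)))) y ≠ 0) with hYdef
  have hρle : ∀ y, |(((4 * sZ (g y) - uf y : ℤ)) : ℝ)| ≤ 256 := by
    intro y
    have hWle : |W (fun x => signOf (decide (Odd (ug x / 2)))) y| ≤ 65536 := by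
      unfold W
      calc |∑ x, signOf (decide (Odd (ug x / 2))) * twist x y| ≤ ∑ x, |signOf (decide (Odd (ug x / 2))) * twist x y| :=
            abs_sum_le_sum_abs _ _
        _ ≤ ∑ x : Fin (8 + 8) → Bool, (1 : ℝ) := sum_le_sum fun x _ => by
            rw [abs_mul]
            rcases Simon.twist_eq_one_or x y with h | h <;> rw [h] <;> unfold signOf <;> split_ifs <;> norm_num
        _ = 65536 := by rw [sum_const, card_univ, Fintype.card_fun, Fintype.card_bool, Fintype.card_fin]; norm_num
    rw [hWd y, abs_mul, abs_of_pos (by norm_num : (0 : ℝ) < 256)] at hWle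
    linarith
  have hYcard : 32 ≤ #Y := by
    -- `8192 = Σ (−1)^g ρ ≤ Σ_{Y} |ρ| ≤ 256·#Y`
    have h1 : (8192 : ℝ) ≤ ∑ y ∈ Y, |(((4 * sZ (g y) - uf y : ℤ)) : ℝ)| := by
      rw [← hSρ, ← sum_filter_add_sum_filter_not univ (fun y : Fin (8 + 8) → Bool =>
        W (fun x => signOf (decide (Odd (ug x / 2)))) y ≠ 0)]
      have hz : ∑ y ∈ univ.filter (fun y : Fin (8 + 8) → Bool => ¬ W (fun x => signOf (decide (Odd (ug x / 2)))) y ≠ 0),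
          signOf (g y) * (((4 * sZ (g y) - uf y : ℤ)) : ℝ) = 0 := by
        refine sum_eq_zero fun y hy => ?_
        have h0 : W (fun x => signOf (decide (Odd (ug x / 2)))) y = 0 := by simpa using (mem_filter.1 hy).2
        rw [hWd y] at h0
        have : (((4 * sZ (g y) - uf y : ℤ)) : ℝ) = 0 := by linarith
        rw [this, mul_zero]
      rw [hz, add_zero]
      refine sum_le_sum fun y _ => ?_
      calc signOf (g y) * (((4 * sZ (g y) - uf y : ℤ)) : ℝ) ≤ |signOf (g y) * (((4 * sZ (g y) - uf y : ℤ)) : ℝ)| := le_abs_self _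
        _ = |(((4 * sZ (g y) - uf y : ℤ)) : ℝ)| := by
            rw [abs_mul]; unfold signOf; split_ifs <;> norm_num
    have h2 : ∑ y ∈ Y, |(((4 * sZ (g y) - uf y : ℤ)) : ℝ)| ≤ 256 * #Y := by
      calc ∑ y ∈ Y, |(((4 * sZ (g y) - uf y : ℤ)) : ℝ)| ≤ ∑ y ∈ Y, (256 : ℝ) := sum_le_sum fun y _ => hρle y
        _ = 256 * #Y := by rw [sum_const, nsmul_eq_mul, mul_comm]
    have : (32 : ℝ) ≤ #Y := by linarith
    exact_mod_cast this
  -- (5) the radical is small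
  have hR : 16 * #(univ.filter fun a : Fin (8 + 8) → Bool => ∀ b, ((decide (Odd (ug zeroVec / 2))) ^^ (decide (Odd (ug a / 2))) ^^
      (decide (Odd (ug b / 2))) ^^ (decide (Odd (ug (bxor a b) / 2)))) = false) < 2 ^ (8 + 8) := by
    have h := st_card_supp_mul_radical_le (fun x => decide (Odd (ug x / 2))) hd₁
    have h' : 32 * #(univ.filter fun a : Fin (8 + 8) → Bool => ∀ b, ((decide (Odd (ug zeroVec / 2))) ^^ (decide (Odd (ug a / 2))) ^^
        (decide (Odd (ug b / 2))) ^^ (decide (Odd (ug (bxor a b) / 2)))) = false) ≤ 2 ^ (8 + 8) :=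
      le_trans (Nat.mul_le_mul_right _ hYcard) h
    omega
  -- (6) three hyperbolic pairs and the 6-flat sign sum `±8`
  obtain ⟨a₀, a₁, a₂, a₃, a₄, a₅, h01, h23, h45, h02, h03, h12, h13, h04, h05, h14, h15, h24, h25, h34, h35⟩ :=
    ss_extract3 _ hd₁ hR
  have hsig := ss_flat_signsum6 _ hd₁ a₀ a₁ a₂ a₃ a₄ a₅ h01 h23 h45 h02 h03 h12 h13 h04 h05 h14 h15 h24 h25 h34 h35 zeroVec
  -- (7) but general flat sums make every 6-flat sum of `τ` vanish mod `16`
  have h16 := fs_flat_sum_dvd (e := 4) g ug hg hug zeroVec ![a₀, a₁, a₂, a₃, a₄, a₅] (by norm_num)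
  obtain ⟨zf, hzf⟩ := fs_sum_signOf_flat_dvd f hf zeroVec ![a₀, a₁, a₂, a₃, a₄, a₅]
  have hsf : (16 : ℤ) ∣ ∑ ε : Fin 6 → Bool, 4 * sZ (f (fun j => zeroVec j ^^
      decide (Odd #(univ.filter fun i : Fin 6 => ε i && (![a₀, a₁, a₂, a₃, a₄, a₅] : Fin 6 → Fin (8 + 8) → Bool) i j)))) := by
    have hcast : ((∑ ε : Fin 6 → Bool, sZ (f (fun j => zeroVec j ^^
        decide (Odd #(univ.filter fun i : Fin 6 => ε i && (![a₀, a₁, a₂, a₃, a₄, a₅] : Fin 6 → Fin (8 + 8) → Bool) i j)))) : ℤ) : ℝ)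
        = ((4 * zf : ℤ) : ℝ) := by
      push_cast
      rw [sum_congr rfl fun ε _ => tp_sZ_cast _, hzf]
      norm_num
    have hz : (∑ ε : Fin 6 → Bool, sZ (f (fun j => zeroVec j ^^
        decide (Odd #(univ.filter fun i : Fin 6 => ε i && (![a₀, a₁, a₂, a₃, a₄, a₅] : Fin 6 → Fin (8 + 8) → Bool) i j)))) : ℤ)
        = 4 * zf := by exact_mod_cast hcast
    rw [← mul_sum, hz]
    exact ⟨zf, by ring⟩
  have hτ16 : (16 : ℤ) ∣ ∑ ε : Fin 6 → Bool, sZ (decide (Odd (ug (fun j => zeroVec j ^^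
      decide (Odd #(univ.filter fun i : Fin 6 => ε i && (![a₀, a₁, a₂, a₃, a₄, a₅] : Fin 6 → Fin (8 + 8) → Bool) i j))) / 2))) := by
    rw [← sum_congr rfl fun ε _ => hτeq _, sum_sub_distrib]
    exact dvd_sub h16 hsf
  have hcast : ((∑ ε : Fin 6 → Bool, sZ (decide (Odd (ug (fun j => zeroVec j ^^
      decide (Odd #(univ.filter fun i : Fin 6 => ε i && (![a₀, a₁, a₂, a₃, a₄, a₅] : Fin 6 → Fin (8 + 8) → Bool) i j))) / 2))) : ℤ) : ℝ) =
      ∑ ε : Fin 6 → Bool, signOf (decide (Odd (ug (fun j => zeroVec j ^^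
        decide (Odd #(univ.filter fun i : Fin 6 => ε i && (![a₀, a₁, a₂, a₃, a₄, a₅] : Fin 6 → Fin (8 + 8) → Bool) i j))) / 2))) := by
    push_cast
    exact sum_congr rfl fun ε _ => tp_sZ_cast _
  rcases hsig with h | h
  · have h8 : (∑ ε : Fin 6 → Bool, sZ (decide (Odd (ug (fun j => zeroVec j ^^
        decide (Odd #(univ.filter fun i : Fin 6 => ε i && (![a₀, a₁, a₂, a₃, a₄, a₅] : Fin 6 → Fin (8 + 8) → Bool) i j))) / 2))) : ℤ) = 8 := by
      have : ((∑ ε : Fin 6 → Bool, sZ (decide (Odd (ug (fun j => zeroVec j ^^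
        decide (Odd #(univ.filter fun i : Fin 6 => ε i && (![a₀, a₁, a₂, a₃, a₄, a₅] : Fin 6 → Fin (8 + 8) → Bool) i j))) / 2))) : ℤ) : ℝ)
          = ((8 : ℤ) : ℝ) := by rw [hcast, h]; norm_num
      exact_mod_cast this
    rw [h8] at hτ16
    omega
  · have h8 : (∑ ε : Fin 6 → Bool, sZ (decide (Odd (ug (fun j => zeroVec j ^^
        decide (Odd #(univ.filter fun i : Fin 6 => ε i && (![a₀, a₁, a₂, a₃, a₄, a₅] : Fin 6 → Fin (8 + 8) → Bool) i j))) / 2))) : ℤ) = -8 := by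
      have : ((∑ ε : Fin 6 → Bool, sZ (decide (Odd (ug (fun j => zeroVec j ^^
        decide (Odd #(univ.filter fun i : Fin 6 => ε i && (![a₀, a₁, a₂, a₃, a₄, a₅] : Fin 6 → Fin (8 + 8) → Bool) i j))) / 2))) : ℤ) : ℝ)
          = ((-8 : ℤ) : ℝ) := by rw [hcast, h]; norm_num
      exact_mod_cast this
    rw [h8] at hτ16
    omega

end Summit.QuantumAdvantage.QuantumAdvantage.Theorems.CubicForrelation.NearExactIsExact

end
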